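import Summits.CriticalPhenomena.Ising3DConformalLimit.Theorems.PerfectScreeningGaussianLimitNotScreenedRegressionDefs
import Summits.CriticalPhenomena.Ising3DConformalLimit.Theorems.PerfectScreeningGaussianLimitNotScreenedDoubleTermLimitShellSums
import HarnessLib

/-!
# Crux `GaussianLimitNotScreened` (stmt-CriticalPhenomena-13886), line `single-layer-linear-regression`:
# the layer mass bound of stub B2b `stub_doubleTermKernelSum` (helper 1/2)

THEOREM-ONLY helper file (no definitions). The (mass) conjunct of the registered stub
`stub_doubleTermKernelSum`: under the crux hypotheses (a non-degenerate, Möbius-covariant pointwise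
scaling limit `(ρ, Δ, S)` of the critical correlators `criticalCorr 3`), for every `R` there is `C`
with

  `Σ_{z ∈ ℤ², |zᵢ| ≤ Rn} n⁻² ⟨σ₀σ_{(0,z)}⟩_{β_c} ≤ C · ⟨σ₀σ_{2n e₀}⟩_{β_c}`   for all large `n`.

Mechanism: the window `Δ ∈ [1/2, 3/4]` of a covariant limit gives `Δ < 1`; the landed near-diagonal
layer shell sum (`stub_doubleTermLimit_nearDiagonal` at `p = 0`, file
`…DoubleTermLimitShellSums.lean`) at scale `(R+1)n` bounds `Σ_{0 < ‖z‖_∞ ≤ M} ⟨σ₀σ_{(0,z)}⟩`,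
`M > 2(R+1)n ≥ Rn`, by `C ((R+1)n)² ⟨σ₀σ_{2(R+1)n e₀}⟩ ≤ C (R+1)² n² ⟨σ₀σ_{2n e₀}⟩` (axis monotonicity,
Messager–Miracle-Solé), and the origin term `n⁻² ⟨σ₀σ₀⟩ = n⁻²` is `≤ ⟨σ₀σ_{2n e₀}⟩` eventually because
`n² ⟨σ₀σ_{2n e₀}⟩ → ∞`.

References: N. H. Bingham, C. M. Goldie, J. L. Teugels, *Regular Variation* (1987), §1.5.6;
A. Messager, S. Miracle-Solé, J. Stat. Phys. 17 (1977).
-/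

noncomputable section

namespace Summit.CriticalPhenomena.Ising3DConformalLimit.Cruxes.GaussianLimitNotScreened.SingleLayerLinearRegression

open MeasureTheory Filter Topology
open Literature.Probability.LatticeModels
open Summit.CriticalPhenomena.Ising3DConformalLimit.MoebiusLimitExistsNegative (delta_mem_Icc_of_covariantLimit)


/-- The transverse box of the line is the tree's sup-norm box: `layerBox R n = box 2 (R n)`.
[folklore] -/
theorem doubleTermKernelSum_layerBox_eq (R n : ℕ) : layerBox R n = box 2 (R * n) := rfl

/-- The layer point over the origin of `ℤ²` is the origin of `ℤ³`. [folklore] -/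
theorem doubleTermKernelSum_cons_zero : (Fin.cons 0 (0 : Fin 2 → ℤ) : Site 3) = 0 := by
  funext i
  refine Fin.cases ?_ (fun j => ?_) i <;> simp

/-- The layer sum over a sup-norm box splits off the origin term `⟨σ₀σ₀⟩ = 1`. [folklore] -/
theorem doubleTermKernelSum_sum_box (M : ℕ) :
    ∑ z ∈ box 2 M, criticalTwoPoint 3 (Fin.cons 0 z) =
      1 + ∑ z ∈ (box 2 M).erase 0, criticalTwoPoint 3 (Fin.cons 0 z) := by
  rw [← Finset.add_sum_erase _ _ (zero_mem_box 2 M), doubleTermKernelSum_cons_zero,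
    criticalTwoPoint_zero']

/-- **Registered bookkeeping sub-goal `doubleTermKernelSum_mass` of stub B2b `stub_doubleTermKernelSum`
(the (mass) conjunct).** Under the crux hypotheses, for every `R` there is `C` with
`Σ_{z ∈ ℤ², |zᵢ| ≤ Rn} n⁻² ⟨σ₀σ_{(0,z)}⟩_{β_c} ≤ C ⟨σ₀σ_{2n e₀}⟩_{β_c}` for all large `n`: the window
`Δ ≤ 3/4 < 1`, the landed near-diagonal layer shell sum at scale `(R+1)n`
(`stub_doubleTermLimit_nearDiagonal`, `p = 0`), axis monotonicity `⟨σ₀σ_{2(R+1)n e₀}⟩ ≤ ⟨σ₀σ_{2n e₀}⟩`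
(Messager–Miracle-Solé) and `n² ⟨σ₀σ_{2n e₀}⟩ → ∞` for the origin term.
[cite: BinghamGoldieTeugels1987, §1.5.6, Karamata's theorem (direct half)] -/
theorem doubleTermKernelSum_mass :
    ∀ (ρ : ℝ → ℝ) (Δ : ℝ) (S : CorrFamily 3), (∀ δ ∈ Set.Ioc (0:ℝ) 1, 0 < ρ δ) →
      HasPointwiseScalingLimit (criticalCorr 3) ρ S → IsNondegenerateTwoPoint S →
      IsMoebiusCovariant Δ S →
      ∀ R : ℕ, ∃ C : ℝ, ∀ᶠ n : ℕ in atTop,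
        ∑ z ∈ layerBox R n, criticalTwoPoint 3 (Fin.cons 0 z) / (n : ℝ) ^ 2 ≤
          C * criticalTwoPoint 3 (Pi.single 0 ((2 * n : ℕ) : ℤ)) := by
  intro ρ Δ S hρ hlim hnd hMo R
  have hrot : IsRotationInvariant S := hMo.isEuclideanInvariant.2
  have hsc : IsScaleCovariant Δ S := hMo.isScaleCovariant
  have hΔ1 : Δ < 1 :=
    lt_of_le_of_lt (delta_mem_Icc_of_covariantLimit hρ hlim hnd hrot hsc).2 (by norm_num)
  obtain ⟨hdiv, C, θ, hC, hθ, -, hnear⟩ := stub_doubleTermLimit_nearDiagonal ρ Δ S hlim hnd hsc hΔ1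
  obtain ⟨N₀, hN₀⟩ := hnear 0
  refine ⟨1 + C * ((R + 1 : ℕ) : ℝ) ^ 2, ?_⟩
  filter_upwards [hdiv.eventually_ge_atTop 1, eventually_ge_atTop (max N₀ 1)] with n h1 hn
  have hnN : N₀ ≤ n := le_of_max_le_left hn
  have hn1 : 1 ≤ n := le_of_max_le_right hn
  have hn' : (0:ℝ) < n := by exact_mod_cast hn1
  have hn'N : N₀ ≤ (R + 1) * n := hnN.trans (Nat.le_mul_of_pos_left n (Nat.succ_pos R))
  obtain ⟨M, hM1, -, hsum⟩ := hN₀ ((R + 1) * n) hn'N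
  simp only [pow_zero, mul_one] at hM1 hsum
  have hgn : 0 ≤ criticalTwoPoint 3 (Pi.single (0 : Fin 3) ((2 * n : ℕ) : ℤ)) :=
    criticalTwoPoint_nonneg' _
  have hanti : criticalTwoPoint 3 (Pi.single (0 : Fin 3) ((2 * ((R + 1) * n) : ℕ) : ℤ)) ≤
      criticalTwoPoint 3 (Pi.single (0 : Fin 3) ((2 * n : ℕ) : ℤ)) :=
    criticalTwoPoint_axis_antitone (show 2 * n ≤ 2 * ((R + 1) * n) by nlinarith)
  have hsub : layerBox R n ⊆ box 2 M := by
    rw [doubleTermKernelSum_layerBox_eq]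
    apply box_mono
    nlinarith
  calc ∑ z ∈ layerBox R n, criticalTwoPoint 3 (Fin.cons 0 z) / (n : ℝ) ^ 2
      = (∑ z ∈ layerBox R n, criticalTwoPoint 3 (Fin.cons 0 z)) / (n : ℝ) ^ 2 := by
        rw [Finset.sum_div]
    _ ≤ (∑ z ∈ box 2 M, criticalTwoPoint 3 (Fin.cons 0 z)) / (n : ℝ) ^ 2 :=
        div_le_div_of_nonneg_right
          (Finset.sum_le_sum_of_subset_of_nonneg hsub fun z _ _ => criticalTwoPoint_nonneg' _)
          (by positivity)
    _ = (1 + ∑ z ∈ (box 2 M).erase 0, criticalTwoPoint 3 (Fin.cons 0 z)) / (n : ℝ) ^ 2 := by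
        rw [doubleTermKernelSum_sum_box]
    _ ≤ ((n:ℝ) ^ 2 * criticalTwoPoint 3 (Pi.single (0 : Fin 3) ((2 * n : ℕ) : ℤ)) +
          C * (((R + 1) * n : ℕ) : ℝ) ^ 2 *
            criticalTwoPoint 3 (Pi.single (0 : Fin 3) ((2 * ((R + 1) * n) : ℕ) : ℤ))) /
          (n : ℝ) ^ 2 := by
        gcongr (?_ + ?_) / _
    _ ≤ ((n:ℝ) ^ 2 * criticalTwoPoint 3 (Pi.single (0 : Fin 3) ((2 * n : ℕ) : ℤ)) +
          C * (((R + 1) * n : ℕ) : ℝ) ^ 2 *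
            criticalTwoPoint 3 (Pi.single (0 : Fin 3) ((2 * n : ℕ) : ℤ))) / (n : ℝ) ^ 2 := by
        gcongr
    _ = (1 + C * ((R + 1 : ℕ) : ℝ) ^ 2) * criticalTwoPoint 3 (Pi.single 0 ((2 * n : ℕ) : ℤ)) := by
        push_cast
        field_simp

end Summit.CriticalPhenomena.Ising3DConformalLimit.Cruxes.GaussianLimitNotScreened.SingleLayerLinearRegression

end
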